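import Mathlib
import HarnessLib

/-!
# `RationalShortRootRigidity` — Step 2 helper (m5): fixed-degree limits of real-rooted polynomials are real-rooted

Helper lemma INSIDE the paper proof of crux `stmt-QuantumFields-23124` (`F4SubCurvatureDoor.RationalShortRootRigidity`,
LINE g15-A of planner ym-idea-3; prover notes HOME l15/PLANAR-LEMMA-DETAILED.md, Step 2 «LIMIT LEMMA» (used in (2c) and
(2d)) — the only analytic input of Step 2; free-hands menu II, item (m5), statement typed in HOME l15/Helpers23124.lean as
`Helpers.RealRootedLimit` — proved here DEF-FREE with that body verbatim):

**Lemma** (`realRootedLimit`).  Let `pₙ, q ∈ ℝ[X]` all have degree exactly `k`, `pₙ → q` coefficientwise, and every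
`pₙ` real-rooted (`card (roots pₙ) = k`).  Then `q` is real-rooted (`card (roots q) = k`).

Proof (induction on `k`; compactness of root tuples one root at a time).  `k = 0` is trivial.  For `k + 1`: the leading
coefficients converge to `a = lc(q) ≠ 0`, so from some index on `|lc(pₙ)| ≥ |a|/2`, and with a uniform bound on the
(convergent) coefficients the Cauchy-type bound `abs_root_le` confines a chosen root `tₙ` of `pₙ` to a fixed interval;
Bolzano–Weierstrass (`tendsto_subseq_of_bounded`) gives a subsequence `t_{φ n} → t₀`.  The quotients
`p_{φ n} /ₘ (X − t_{φ n})` have degree `k`, are real-rooted, and converge coefficientwise to `q /ₘ (X − t₀)` (explicit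
synthetic-division formula `Polynomial.coeff_divByMonic_X_sub_C`), so by induction `q /ₘ (X − t₀)` is real-rooted;
and `q(t₀) = lim p_{φ n}(t_{φ n}) = 0`, so `q = (X − t₀)·(q /ₘ (X − t₀))` has `k + 1` real roots.

Mathlib only; THEOREMS ONLY (no definitions); no named facts; no `sorry`; default heartbeats.  Nothing about the crux
23124, the route's rung or the Yang–Mills mass gap is proved here.  Free-hands seat `ym-line-frs-p2` g10 (announced on
the owner's bus 2026-08-28T20:11Z), `--supports stmt-QuantumFields-23124`.
-/

set_option autoImplicit false

namespace Summit.QuantumFields.YangMills.Theorems.RationalShortRootRigidity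

open Filter Topology Finset Polynomial
open scoped BigOperators Polynomial

/-! ## 1. A Cauchy-type root bound and uniform coefficient bounds -/

/-- Root bound: if `|coeff i| ≤ B` for `i < m = natDegree p` and `0 < c ≤ |coeff m|`, every real root `t` of `p` has
`|t| ≤ max 1 (m·B/c)`. [folklore] -/
theorem abs_root_le (p : ℝ[X]) (m : ℕ) (B c t : ℝ) (hm : p.natDegree = m)
    (hB : ∀ i, i < m → |p.coeff i| ≤ B) (hc : 0 < c) (hcm : c ≤ |p.coeff m|) (ht : p.IsRoot t) :
    |t| ≤ max 1 (m * B / c) := by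
  have hsum : p.eval t = ∑ i ∈ range (m + 1), p.coeff i * t ^ i := eval_eq_sum_range' (by omega) t
  rw [ht.eq_zero, sum_range_succ] at hsum
  -- `m = 0` is impossible: `p` would be a non-zero constant with a root
  rcases Nat.eq_zero_or_pos m with hm0 | hmpos
  · exfalso
    subst hm0
    simp only [range_zero, sum_empty, pow_zero, mul_one, zero_add] at hsum
    rw [← hsum, abs_zero] at hcm
    exact absurd hcm (not_le.2 hc)
  by_cases h1 : |t| ≤ 1
  · exact h1.trans (le_max_left _ _)
  rw [not_le] at h1
  refine le_max_of_le_right ?_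
  rw [le_div_iff₀ hc]
  set s := |t| with hs_def
  have hs1 : 1 ≤ s := h1.le
  have hspos : 0 < s := one_pos.trans h1
  -- `|coeff m|·s^m ≤ m·B·s^(m−1)`
  have hkey : |p.coeff m| * s ^ m ≤ (m : ℝ) * (B * s ^ (m - 1)) := by
    have h2 : p.coeff m * t ^ m = -∑ i ∈ range m, p.coeff i * t ^ i := by linarith [hsum]
    calc |p.coeff m| * s ^ m = |p.coeff m * t ^ m| := by rw [abs_mul, abs_pow]
      _ = |∑ i ∈ range m, p.coeff i * t ^ i| := by rw [h2, abs_neg]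
      _ ≤ ∑ i ∈ range m, |p.coeff i * t ^ i| := abs_sum_le_sum_abs _ _
      _ ≤ ∑ i ∈ range m, B * s ^ (m - 1) := sum_le_sum fun i hi => ?_
      _ = (m : ℝ) * (B * s ^ (m - 1)) := by rw [sum_const, card_range, nsmul_eq_mul]
    rw [abs_mul, abs_pow]
    have him : i < m := mem_range.1 hi
    exact mul_le_mul (hB i him) (pow_le_pow_right₀ hs1 (by omega)) (pow_nonneg hspos.le _)
      ((abs_nonneg _).trans (hB i him))
  -- divide by `s^(m−1) > 0`
  have hsm : s ^ m = s * s ^ (m - 1) := by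
    rw [← pow_succ', Nat.sub_add_cancel hmpos]
  have h3 : (c * s) * s ^ (m - 1) ≤ ((m : ℝ) * B) * s ^ (m - 1) := by
    calc (c * s) * s ^ (m - 1) = c * s ^ m := by rw [hsm]; ring
      _ ≤ |p.coeff m| * s ^ m := mul_le_mul_of_nonneg_right hcm (pow_nonneg hspos.le _)
      _ ≤ (m : ℝ) * (B * s ^ (m - 1)) := hkey
      _ = ((m : ℝ) * B) * s ^ (m - 1) := by ring
  have h4 : c * s ≤ (m : ℝ) * B := le_of_mul_le_mul_right h3 (pow_pos hspos _)
  rw [mul_comm]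
  exact h4

/-- Coefficientwise convergent sequences of polynomials have uniformly bounded coefficients below any fixed index.
[folklore] -/
theorem exists_coeff_bound (p : ℕ → ℝ[X]) (q : ℝ[X]) (m : ℕ)
    (hcoef : ∀ i : ℕ, Tendsto (fun n => (p n).coeff i) atTop (𝓝 (q.coeff i))) :
    ∃ B : ℝ, ∀ n i, i < m → |(p n).coeff i| ≤ B := by
  have hb : ∀ i, ∃ R : ℝ, ∀ n, |(p n).coeff i| ≤ R := by
    intro i
    obtain ⟨R, hR⟩ := (Metric.isBounded_range_of_tendsto _ (hcoef i)).subset_closedBall (0 : ℝ)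
    refine ⟨R, fun n => ?_⟩
    have := hR ⟨n, rfl⟩
    rwa [Metric.mem_closedBall, dist_zero_right, Real.norm_eq_abs] at this
  choose R hR using hb
  refine ⟨∑ j ∈ range m, |R j|, fun n i hi => (hR i n).trans ((le_abs_self _).trans ?_)⟩
  exact single_le_sum (f := fun j => |R j|) (fun j _ => abs_nonneg (R j)) (mem_range.2 hi)

/-! ## 2. The limit lemma -/

/-- **Limit lemma** (m5; Step 2 of the paper proof of 23124): a coefficientwise limit of real-rooted real polynomials of
fixed degree `k` is real-rooted.  The statement is the body of `Helpers.RealRootedLimit` (HOME l15/Helpers23124.lean)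
verbatim. [folklore] -/
theorem realRootedLimit :
    ∀ (k : ℕ) (p : ℕ → ℝ[X]) (q : ℝ[X]),
      (∀ n, (p n).natDegree = k) → q.natDegree = k →
      (∀ i : ℕ, Tendsto (fun n => (p n).coeff i) atTop (nhds (q.coeff i))) →
      (∀ n, ((p n).roots).card = k) →
      (q.roots).card = k := by
  intro k
  induction k with
  | zero =>
    intro p q _ hq _ _
    exact Nat.le_zero.1 (hq ▸ q.card_roots')
  | succ k IH =>
    intro p q hdeg hq hcoef hroots
    -- the limit leading coefficient `a ≠ 0`
    set a : ℝ := q.coeff (k + 1) with ha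
    have hq0 : q ≠ 0 := ne_zero_of_natDegree_gt (n := 0) (by omega)
    have ha0 : a ≠ 0 := by
      rw [ha, ← hq, coeff_natDegree]; exact leadingCoeff_ne_zero.2 hq0
    have hp0 : ∀ n, p n ≠ 0 := fun n => ne_zero_of_natDegree_gt (n := 0) (by rw [hdeg n]; omega)
    -- from some index on the leading coefficients stay away from zero
    obtain ⟨N, hN⟩ : ∃ N, ∀ n, N ≤ n → |a| / 2 ≤ |(p n).coeff (k + 1)| := by
      have hε : (0 : ℝ) < |a| / 2 := half_pos (abs_pos.2 ha0)
      obtain ⟨N, hN⟩ := Metric.tendsto_atTop.1 (hcoef (k + 1)) (|a| / 2) hε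
      refine ⟨N, fun n hn => ?_⟩
      have h1 := hN n hn
      rw [Real.dist_eq] at h1
      have h2 := abs_sub_abs_le_abs_sub a ((p n).coeff (k + 1))
      rw [abs_sub_comm] at h2
      linarith
    -- a root `t n` of every `p n`; the roots `t (n + N)` are uniformly bounded
    have hroot : ∀ n, ∃ t : ℝ, (p n).IsRoot t := by
      intro n
      have hpos : 0 < Multiset.card (p n).roots := by rw [hroots n]; exact Nat.succ_pos k
      obtain ⟨t, ht⟩ := Multiset.card_pos_iff_exists_mem.1 hpos
      exact ⟨t, (mem_roots (hp0 n)).1 ht⟩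
    choose t ht using hroot
    obtain ⟨B, hB⟩ := exists_coeff_bound p q (k + 1) hcoef
    set R : ℝ := max 1 (((k + 1 : ℕ) : ℝ) * B / (|a| / 2)) with hR
    have htR : ∀ n, t (n + N) ∈ Set.Icc (-R) R := by
      intro n
      have := abs_root_le (p (n + N)) (k + 1) B (|a| / 2) (t (n + N)) (hdeg _) (fun i hi => hB _ i hi)
        (half_pos (abs_pos.2 ha0)) (hN _ (Nat.le_add_left N n)) (ht _)
      exact Set.mem_Icc.2 (abs_le.1 this)
    obtain ⟨t₀, -, ψ, hψ, hlim⟩ := tendsto_subseq_of_bounded (Metric.isBounded_Icc (-R) R) htR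
    -- the subsequence `φ n = ψ n + N`
    set φ : ℕ → ℕ := fun n => ψ n + N with hφ
    have hφmono : StrictMono φ := fun m n hmn => Nat.add_lt_add_right (hψ hmn) N
    have hφtop : Tendsto φ atTop atTop := hφmono.tendsto_atTop
    have hlim' : Tendsto (fun n => t (φ n)) atTop (𝓝 t₀) := hlim
    -- the quotients by the chosen roots
    set Q : ℕ → ℝ[X] := fun n => p (φ n) /ₘ (X - C (t (φ n))) with hQ
    set q₁ : ℝ[X] := q /ₘ (X - C t₀) with hq₁
    have hQdeg : ∀ n, (Q n).natDegree = k := by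
      intro n
      show (p (φ n) /ₘ (X - C (t (φ n)))).natDegree = k
      rw [natDegree_divByMonic _ (monic_X_sub_C _), hdeg, natDegree_X_sub_C]
      omega
    have hq₁deg : q₁.natDegree = k := by
      rw [hq₁, natDegree_divByMonic _ (monic_X_sub_C _), hq, natDegree_X_sub_C]
      omega
    have hQcoef : ∀ i : ℕ, Tendsto (fun n => (Q n).coeff i) atTop (𝓝 (q₁.coeff i)) := by
      intro i
      have hform : ∀ n, (Q n).coeff i =
          ∑ j ∈ Icc (i + 1) (k + 1), t (φ n) ^ (j - (i + 1)) * (p (φ n)).coeff j := by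
        intro n
        show (p (φ n) /ₘ (X - C (t (φ n)))).coeff i = _
        rw [coeff_divByMonic_X_sub_C, hdeg]
      have hform₁ : q₁.coeff i = ∑ j ∈ Icc (i + 1) (k + 1), t₀ ^ (j - (i + 1)) * q.coeff j := by
        rw [hq₁, coeff_divByMonic_X_sub_C, hq]
      simp_rw [hform]
      rw [hform₁]
      exact tendsto_finsetSum _ fun j _ => (hlim'.pow _).mul ((hcoef j).comp hφtop)
    have hQroots : ∀ n, Multiset.card (Q n).roots = k := by
      intro n
      have hfac : (X - C (t (φ n))) * Q n = p (φ n) := mul_divByMonic_eq_iff_isRoot.2 (ht _)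
      have hne : (X - C (t (φ n))) * Q n ≠ 0 := by rw [hfac]; exact hp0 _
      have h := hroots (φ n)
      rw [← hfac, roots_mul hne, roots_X_sub_C, Multiset.card_add, Multiset.card_singleton] at h
      omega
    have hq₁roots : Multiset.card q₁.roots = k := IH Q q₁ hQdeg hq₁deg hQcoef hQroots
    -- `t₀` is a root of `q`
    have hqt₀ : q.IsRoot t₀ := by
      have h1 : Tendsto (fun n => (p (φ n)).eval (t (φ n))) atTop (𝓝 (q.eval t₀)) := by
        have hform : ∀ n, (p (φ n)).eval (t (φ n)) =
            ∑ i ∈ range (k + 2), (p (φ n)).coeff i * t (φ n) ^ i :=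
          fun n => eval_eq_sum_range' (by rw [hdeg]; omega) _
        rw [eval_eq_sum_range' (show q.natDegree < k + 2 by omega)]
        simp_rw [hform]
        exact tendsto_finsetSum _ fun i _ => ((hcoef i).comp hφtop).mul (hlim'.pow _)
      have h2 : (fun n => (p (φ n)).eval (t (φ n))) = fun _ => (0 : ℝ) := funext fun n => (ht (φ n)).eq_zero
      rw [h2] at h1
      exact IsRoot.def.2 (tendsto_nhds_unique tendsto_const_nhds h1).symm
    -- conclude: `q = (X − t₀) · q₁`
    have hfac : (X - C t₀) * q₁ = q := mul_divByMonic_eq_iff_isRoot.2 hqt₀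
    have hne : (X - C t₀) * q₁ ≠ 0 := by rw [hfac]; exact hq0
    rw [← hfac, roots_mul hne, roots_X_sub_C, Multiset.card_add, Multiset.card_singleton, hq₁roots]
    omega

end Summit.QuantumFields.YangMills.Theorems.RationalShortRootRigidity
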